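import Literature.AnabelianGeometry.EtaleTheta.Discharge.Sec5GaloisShadowOfBaseShadow
import Literature.AnabelianGeometry.EtaleTheta.Discharge.Sec5UnitsFixedByGeometricOfCnst
import Literature.AnabelianGeometry.EtaleTheta.Discharge.Sec5Prop55CarrierInputsGalois
import HarnessLib

/-!
# [EtTh] Thm. 5.6 (i) proof at the assembled §5 data: the γ-package `hΓ` (T56-L02 ⊕ Cor. 2.18 (i) ⊕ T56-L09c) and the
# `hconst`-discharged T56-L09b / P55-L02b ON THE v2 SUBQUOTIENT RECORD `ThetaSubquotientProjGalois` — PROOF-ONLY, proofs verbatim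

S. Mochizuki, *The étale theta function and its Frobenioid-theoretic manifestations*, Publ. RIMS **45** (2009)
[cite: MochizukiEtTh2009, Thm 5.6 proof p.328–329 (PDF pp.102–103); Prop 5.5 p.327 (PDF p.101); Prop 3.4 (ii) p.300 (PDF p.74);
§5 p.327 (PDF p.101) «these subquotients determine subquotients `Aut_D(D) ↠ Aut^Θ_D(D)`»].
abc-iut cell, layer L2, seat abc-iut-w6-d020 (gen 7), row «(w4-S) V1→V2 PORT — deep EndKnit*/AllLeavesV3*/KummerComparisonInputsLevel*
heads» (abc-iut-L2-lead gen 7 R957; VNEXT-CENSUS-L2 §G5 add. 11 standing row «(w4) V1→V2 MECHANICAL PORT»), layer S0 (the two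
`P`-binding middle-layer inputs that do not pass through abc-iut-w5-d013's (w4-R) carrier heads).

WHY.  abc-iut-w5-d013's `Sec5GaloisShadowOfBaseShadow` (the produced γ-package `hΓ` of the K4 knits, p.328–329) and abc-iut-w5-d020's
`Sec5UnitsFixedByGeometricOfCnst` (T56-L09b / P55-L02b with `hconst` discharged by Prop. 3.4 (ii) constants, p.329 l.19–21) each
carry theorems over the binder `(P : ThetaSubquotientProj 𝔉)` — abc-iut-L2-t4's v1 subquotient record, whose field `proj_surjective`
asks `P_E ↠ (l·Δ_Θ)_E` at EVERY base object and which is EMPTY at the cell's root model for `l` odd (abc-iut-L2-t9 p456572,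
p476337), so there those theorems quantify over an empty type.  abc-iut-w6-d079's v2 record `ThetaSubquotientProjGalois 𝔉 Gal`
(p481123; surjectivity only at the objects singled out by `Gal : D → Prop`, as print uses it — Prop. 5.1 / Lemma 5.9 run over
connected GALOIS coverings) is INHABITED at every `ofSetting` carrier (p481568) and at every level stub of the junction data
(p486065 `RigidData.nonempty_thetaSubquotientProjGalois_of_stub_eq_levelStub`), and carries the v2 predicate twins
`Thm56Sub.DeltaTransportCompatGal` / `UnitsCentralUnderLDeltaGal` / `CyclotomeCentralUnderLDeltaGal` (p484491; the SAME formulas —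
they read `P` only through `pre` / `proj` at `Base(B_N)`).

THIS FILE re-keys on the v2 record, binder `{Gal : D → Prop} (P : ThetaSubquotientProjGalois 𝔉 Gal)`, statements otherwise and
proofs VERBATIM (none of the source arguments uses `proj_surjective`), names = the originals with suffix `_galois`:
* `gammaPackage_of_baseShadow_of_deltaTransportCompat_galois` — the binder `hΓ` of the K4 knit PRODUCED over `B^temp(Π^tp_X)⁰`,
  its `haΨ`-conjunct from the γ-free T56-L09c predicate `Thm56Sub.DeltaTransportCompatGal` (twin of abc-iut-w5-d013's head; the
  `P`-free producer `gammaPackage_of_baseShadow_of_forall` — T56-L02 via [SemiAnbd] Prop. 3.2 and Cor. 2.18 (i) BY NAME — is used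
  BY NAME, not restated);
* `unitsCentralUnderLDelta_ofBiKummerData_of_cnst_galois` / `cyclotomeCentralUnderLDelta_ofBiKummerData_of_cnst_galois` —
  T56-L09b / P55-L02b at `ofBiKummerData` with `hconst` DISCHARGED by abc-iut-L2-t3's `Prop34Cnst` and the origin clause `hΔcnst`
  (twins of abc-iut-w5-d020's heads; the `P`-free `hconst_ofBiKummerData_of_cnst` BY NAME, the v2 carrier lemma
  `unitsCentralUnderLDelta_ofBiKummerData_galois` = abc-iut-w5-d013's p487908).
0 `def`s; no v1 file is edited; the v1 heads are the `P.toGalois Gal` instances of these (abc-iut-w6-d079's `Iff.rfl` bridges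
`deltaTransportCompatGal_toGalois_iff` / `unitsCentralUnderLDeltaGal_toGalois_iff`).

HONEST FRAMING: a typing repair of the cell's OWN record (weaker quantifier on `P`); kernel-checked implications between typed
statements over abc-iut-L2-t4's assembled §5 data; nothing of [EtTh] (a refereed paper) is asserted; the existence of the data for
an actual curve is not claimed here; typed ≠ discharged; nothing here bears on [IUTchIII] Cor. 3.12 — no side taken; nothing
here asserts abc proved or refuted.
-/

noncomputable section

namespace Literature.AnabelianGeometry.EtaleTheta

open CategoryTheory Opposite Literature.AlgebraicGeometry.Frobenioids Literature.AnabelianGeometry.SemiGraphs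
  Literature.AnabelianGeometry.SemiGraphs.GaloisObjects FrobenioidCyclotomicRigidity

namespace ThetaFrobenioid

universe u₀ v₀ u₁ v₁ u v w

/-! ### (1) The γ-package `hΓ` over `B^temp(Π^tp_X)⁰` from the v2 predicate `DeltaTransportCompatGal` -/

section GammaPackage

variable {K : Type u₀} [Field K] {X : SemiGraphs.TemperedArithmeticGroup.{u₀} K} {D₀ : Type u₀} [Category.{v₀} D₀]
  {V : FrdIMonoidStub.{w}} {T₀ : RealifiedDivisorMonoids (D₀ := D₀) V}
  {VD : FrdICatStub.{u₀ + 1, u₀, w} (ConnectedPart (BTemp X.Pi))}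
  {S : BiKummerSetting X T₀ (ConnectedPart (BTemp X.Pi)) VD}
  {pullFrac : ∀ {A A' : S.C} (_ : A' ⟶ A), S.biratUnits A → S.biratUnits A'}
  {lv N : ℕ+} {θ : S.biratUnits S.Aodot} {Bl : S.C} {Pl : S.FractionPair θ Bl} {Rl : S.NthRoot θ Pl lv pullFrac}
  {l' : ℕ} {RD : RigidData.{max u₀ w} N l'}
  (h : ModelFrobenioid.Hypotheses S.tf.divisorMonoid S.tf.ratFnFunctor)
  (toB : ∀ A : S.C, S.biratUnits A →* S.tf.biratUnitsModel A)
  (Q : FrobenioidTheta.ThetaSubquotientStub.{w} (ConnectedPart (BTemp X.Pi))) (odd_l : Odd (lv : ℕ))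
  (R : S.NthRoot Rl.root Rl.pair N pullFrac) (ιX : RD.PiX ≃ₜ* X.Pi)
  (hopen : IsOpen ((S.galoisSurj R.AN.base R.αData.isGalois).ker : Set X.Pi)) (σ : Aut R.AN.base →* Aut R.AN)
  (K' : Type w) [Field K'] (constEmb : K'ˣ →* S.tf.biratUnitsModel R.BN) (constEmb_injective : Function.Injective constEmb)
  (hdivc : ∀ g : Aut R.BN.base,
    ModelFrobenioid.div ((σ ((BiKummerSetting.NthRoot.baseIso S R).conjAut.symm g)).hom ≫ R.pair.num) =
      ModelFrobenioid.div R.pair.num)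
  (hdivp : ∀ y : RD.PiYdd,
    ModelFrobenioid.div ((σ (S.galoisSurj R.AN.base R.αData.isGalois (ιX y.1))).hom ≫ R.pair.den) =
      ModelFrobenioid.div R.pair.den)
  (hg : ∀ (A : ConnectedPart (BTemp X.Pi)) (hA : S.IsGaloisObj A), ∃ hA' : SemiGraphs.IsGaloisObj A.obj,
    ∀ g : X.Pi, (S.galoisSurj A hA g).hom.hom = (galoisSurjOf X.isTempered A.obj hA' g).hom)
  (hσ : ∀ g : Aut R.AN.base, ModelFrobenioid.baseMap (σ g).hom = g.hom)
  (h218 : RD.Cor218_i) {Gal : ConnectedPart (BTemp X.Pi) → Prop}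

include hg hσ h218

/-- (v2 record; abc-iut-w5-d013's `gammaPackage_of_baseShadow_of_deltaTransportCompat` VERBATIM.) **The binder `hΓ` of the K4 knit
PRODUCED — `haΨ` from the γ-FREE typed T56-L09c predicate** `Thm56Sub.DeltaTransportCompatGal` (abc-iut-w6-d079's v2 twin of
abc-iut-w5-d020's predicate) for the `B_N`-transport `θ′ := autBaseIsoAB⁻¹-conjugate of θA` of each admissible base shadow, together
with the knit's own binders `hpre` / `hP` (the subquotient datum at `B_N^bs` reads `l·Δ_Θ` through `ρ`): since `θ′ (ρ k) = ρ (γ k)`,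
compatibility of `aΨ` with `θ′` on `P.pre` IS compatibility with `γ` on `l·Δ_Θ ∩ Π^tp_Ÿ`.
[cite: MochizukiEtTh2009, Thm 5.6 proof p.329 (PDF p.103)] -/
theorem gammaPackage_of_baseShadow_of_deltaTransportCompat_galois
    (Ψ : S.C ≌ S.C) (Ψbs : ConnectedPart (BTemp X.Pi) ⥤ ConnectedPart (BTemp X.Pi)) [Ψbs.IsEquivalence]
    (eΨ : Ψ.functor ⋙ (ofBiKummerData h toB Q odd_l R ιX hopen σ K' constEmb constEmb_injective hdivc hdivp).base ≅
      (ofBiKummerData h toB Q odd_l R ιX hopen σ K' constEmb constEmb_injective hdivc hdivp).base ⋙ Ψbs)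
    (α : Ψ.functor.obj (ofBiKummerData h toB Q odd_l R ιX hopen σ K' constEmb constEmb_injective hdivc hdivp).AN ≅
      (ofBiKummerData h toB Q odd_l R ιX hopen σ K' constEmb constEmb_injective hdivc hdivp).AN)
    (e : RD.mu → (ofBiKummerData h toB Q odd_l R ιX hopen σ K' constEmb constEmb_injective hdivc hdivp).lDeltaModN
      (ofBiKummerData h toB Q odd_l R ιX hopen σ K' constEmb constEmb_injective hdivc hdivp).BN)
    (P : ThetaSubquotientProjGalois
      (ofBiKummerData h toB Q odd_l R ιX hopen σ K' constEmb constEmb_injective hdivc hdivp) Gal)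
    (hpre : ∀ k : RD.PiYdd, (k : RD.PiX) ∈ RD.lDeltaTheta → rhoOfBiKummerData R ιX k ∈ P.pre _)
    (hP : ∀ (k : RD.PiYdd) (hk : (k : RD.PiX) ∈ RD.lDeltaTheta) (hm : rhoOfBiKummerData R ιX k ∈ P.pre _),
      (QuotientGroup.mk (P.proj _ ⟨rhoOfBiKummerData R ιX k, hm⟩) :
          (ofBiKummerData h toB Q odd_l R ιX hopen σ K' constEmb constEmb_injective hdivc hdivp).lDeltaModN
            (ofBiKummerData h toB Q odd_l R ιX hopen σ K' constEmb constEmb_injective hdivc hdivp).BN) =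
        e (RD.thetaMod ⟨k, hk⟩))
    (β : Ψ.functor.obj (ofBiKummerData h toB Q odd_l R ιX hopen σ K' constEmb constEmb_injective hdivc hdivp).BN ≅
      (ofBiKummerData h toB Q odd_l R ιX hopen σ K' constEmb constEmb_injective hdivc hdivp).BN)
    (aΨ : ∀ A : S.C, (ofBiKummerData h toB Q odd_l R ιX hopen σ K' constEmb constEmb_injective hdivc hdivp).lDeltaModN A ≃*
      (ofBiKummerData h toB Q odd_l R ιX hopen σ K' constEmb constEmb_injective hdivc hdivp).lDeltaModN (Ψ.functor.obj A))
    (hΔ : ∀ θA : Aut R.AN.base ≃* Aut R.AN.base,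
      (∀ f : Aut R.AN, (PreFrobenioid.baseFunctor S.F).mapIso (α.symm ≪≫ Ψ.functor.mapIso f ≪≫ α) =
        θA ((PreFrobenioid.baseFunctor S.F).mapIso f)) →
      Thm56Sub.DeltaTransportCompatGal (ofBiKummerData h toB Q odd_l R ιX hopen σ K' constEmb constEmb_injective hdivc hdivp)
        Ψ β aΨ
        (((ofBiKummerData h toB Q odd_l R ιX hopen σ K' constEmb constEmb_injective hdivc hdivp).autBaseIsoAB.symm.trans
            θA).trans (ofBiKummerData h toB Q odd_l R ιX hopen σ K' constEmb constEmb_injective hdivc hdivp).autBaseIsoAB)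
        P) :
    ∀ θA : Aut R.AN.base ≃* Aut R.AN.base,
      (∀ f : Aut R.AN, (PreFrobenioid.baseFunctor S.F).mapIso (α.symm ≪≫ Ψ.functor.mapIso f ≪≫ α) =
        θA ((PreFrobenioid.baseFunctor S.F).mapIso f)) →
      ∃ γ : RD.PiX ≃ₜ* RD.PiX,
        (∀ y : RD.PiX,
          (((ofBiKummerData h toB Q odd_l R ιX hopen σ K' constEmb constEmb_injective hdivc hdivp).autBaseIsoAB.symm.trans
              θA).trans (ofBiKummerData h toB Q odd_l R ιX hopen σ K' constEmb constEmb_injective hdivc hdivp).autBaseIsoAB)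
            (rhoOfBiKummerData R ιX y) = rhoOfBiKummerData R ιX (γ y)) ∧
        RD.PiYdd.map γ.toMulEquiv.toMonoidHom = RD.PiYdd ∧
        RD.lDeltaTheta.map γ.toMulEquiv.toMonoidHom = RD.lDeltaTheta ∧
        ∀ (k : RD.PiYdd) (hk : (k : RD.PiX) ∈ RD.lDeltaTheta) (hk' : γ k ∈ RD.lDeltaTheta),
          (ofBiKummerData h toB Q odd_l R ιX hopen σ K' constEmb constEmb_injective hdivc hdivp).lDeltaModNMap β.hom
              (aΨ _ (e (RD.thetaMod ⟨k, hk⟩))) = e (RD.thetaMod ⟨γ k, hk'⟩) := by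
  refine gammaPackage_of_baseShadow_of_forall h toB Q odd_l R ιX hopen σ K' constEmb constEmb_injective hdivc hdivp hg hσ h218 Ψ Ψbs eΨ
    α e β aΨ fun θA hθ γ hγ k hk hk' => ?_
  -- membership in `θ⁻¹(l·Δ_Θ)` forces membership in `Π^tp_Ÿ` (Prop. 2.14 (i): `(l·Δ_Θ) ⊆ (Δ^tp_Ÿ)^Θ`)
  have hY : (γ k : RD.PiX) ∈ RD.PiYdd := (Subgroup.mem_inf.mp (RD.lDeltaTheta_le hk')).1
  obtain ⟨hθg, hcompat⟩ := hΔ θA hθ (rhoOfBiKummerData R ιX k) (hpre k hk)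
  have hm' : rhoOfBiKummerData R ιX (⟨γ k, hY⟩ : RD.PiYdd) ∈ P.pre _ := hpre ⟨γ k, hY⟩ hk'
  rw [← hP k hk (hpre k hk), hcompat, ← hP ⟨γ k, hY⟩ hk' hm']
  congr 2
  exact Subtype.ext (hγ k)

end GammaPackage

/-! ### (2) T56-L09b / P55-L02b at `ofBiKummerData` with `hconst` DISCHARGED by Prop. 3.4 (ii) constants, on the v2 record -/

section Cnst

variable {K : Type u₀} [Field K]
variable {X : SemiGraphs.TemperedArithmeticGroup.{u₀} K} {D₀ : Type u₀} [Category.{v₀} D₀]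
  {V : FrdIMonoidStub.{w}} {T₀ : RealifiedDivisorMonoids (D₀ := D₀) V} {D : Type u} [Category.{v} D]
  {VD : FrdICatStub.{u, v, w} D} {S : BiKummerSetting X T₀ D VD}
  {pullFrac : ∀ {A A' : S.C} (_ : A' ⟶ A), S.biratUnits A → S.biratUnits A'}
  {lv N : ℕ+} {T : ThetaEnvData.{max v w} N} {θ : S.biratUnits S.Aodot} {Bl : S.C}
  {Pl : S.FractionPair θ Bl} {Rl : S.NthRoot θ Pl lv pullFrac}
  (h : ModelFrobenioid.Hypotheses S.tf.divisorMonoid S.tf.ratFnFunctor)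
  (toB : ∀ A : S.C, S.biratUnits A →* S.tf.biratUnitsModel A) (Q : FrobenioidTheta.ThetaSubquotientStub.{w} D)
  (odd_l : Odd (lv : ℕ)) (R : S.NthRoot Rl.root Rl.pair N pullFrac) (ιX : T.PiX ≃ₜ* X.Pi)
  (hopen : IsOpen ((S.galoisSurj R.AN.base R.αData.isGalois).ker : Set X.Pi)) (σ : Aut R.AN.base →* Aut R.AN)
  (K' : Type w) [Field K'] (constEmb : K'ˣ →* S.tf.biratUnitsModel R.BN)
  (constEmb_injective : Function.Injective constEmb)
  (hdivc : ∀ g : Aut R.BN.base,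
    ModelFrobenioid.div ((σ ((BiKummerSetting.NthRoot.baseIso S R).conjAut.symm g)).hom ≫ R.pair.num) =
      ModelFrobenioid.div R.pair.num)
  (hdivp : ∀ y : T.PiYdd,
    ModelFrobenioid.div ((σ (S.galoisSurj R.AN.base R.αData.isGalois (ιX y.1))).hom ≫ R.pair.den) =
      ModelFrobenioid.div R.pair.den)
  {Dcnst : Type u₁} [Category.{v₁} Dcnst] {cnst : D₀ ⥤ Dcnst} {Gal : D → Prop}

/-- (v2 record; abc-iut-w5-d020's `unitsCentralUnderLDelta_ofBiKummerData_of_cnst` VERBATIM.) **EtTh:Thm5.6(i)/T56-L09b at the assembled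
§5 data with `hconst` DISCHARGED** — `Thm56Sub.UnitsCentralUnderLDeltaGal (ofBiKummerData …) P` (the lifts `s^⊓-gp_N(g)` of the part
over `(l·Δ_Θ)_{B_N}` commute with `O^×(B_N)`, p.329 (PDF p.103) l.19–21) from abc-iut-w5-d013's v2 carrier lemma
`unitsCentralUnderLDelta_ofBiKummerData_galois` (p487908), modulo: the section property `hσ` ([FrdI] Prop. 5.6), `hgeom` (the part
over `(l·Δ_Θ)_{B_N}` is geometric; MERGE-PLAN row 2), abc-iut-L2-t3's `Prop34Cnst` (Prop. 3.4 (ii)) and the origin clause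
`hΔcnst` (§3 p.298 (PDF p.72)).  [cite: MochizukiEtTh2009, Thm 5.6 proof p.329 (PDF p.103); Prop 3.4 (ii) p.300 (PDF p.74)] -/
theorem unitsCentralUnderLDelta_ofBiKummerData_of_cnst_galois
    (hσ : ∀ g : Aut R.AN.base, ModelFrobenioid.baseMap (σ g).hom = g.hom)
    (P : ThetaSubquotientProjGalois
      (ofBiKummerData h toB Q odd_l R ιX hopen σ K' constEmb constEmb_injective hdivc hdivp) Gal)
    (hgeom : P.pre R.BN.base ≤ T.aug.ker.map (rhoOfBiKummerData R ιX))
    (hP34 : RealifiedDivisorMonoids.Prop34Cnst T₀ cnst)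
    (hΔcnst : ∀ δ ∈ T.aug.ker,
      cnst.map (S.tf.base.map (rhoOfBiKummerData R ιX δ).hom) = 𝟙 (cnst.obj (S.tf.base.obj R.BN.base))) :
    Thm56Sub.UnitsCentralUnderLDeltaGal
      (ofBiKummerData h toB Q odd_l R ιX hopen σ K' constEmb constEmb_injective hdivc hdivp) P :=
  unitsCentralUnderLDelta_ofBiKummerData_galois h toB Q odd_l R ιX hopen σ K' constEmb constEmb_injective hdivc hdivp hσ P
    hgeom (hconst_ofBiKummerData_of_cnst h R ιX hP34 hΔcnst)

/-- (v2 record; abc-iut-w5-d020's `cyclotomeCentralUnderLDelta_ofBiKummerData_of_cnst` VERBATIM.) **EtTh:Prop5.5/P55-L02b at the assembled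
§5 data with `hconst` DISCHARGED** — the lifts commute with `μ_N(B_N)` (`Thm56Sub.CyclotomeCentralUnderLDeltaGal`), by abc-iut-w6-d079's
`Thm56Sub.cyclotomeCentral_of_unitsCentral_gal`.  [cite: MochizukiEtTh2009, Prop 5.5 proof p.327 (PDF p.101)] -/
theorem cyclotomeCentralUnderLDelta_ofBiKummerData_of_cnst_galois
    (hσ : ∀ g : Aut R.AN.base, ModelFrobenioid.baseMap (σ g).hom = g.hom)
    (P : ThetaSubquotientProjGalois
      (ofBiKummerData h toB Q odd_l R ιX hopen σ K' constEmb constEmb_injective hdivc hdivp) Gal)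
    (hgeom : P.pre R.BN.base ≤ T.aug.ker.map (rhoOfBiKummerData R ιX))
    (hP34 : RealifiedDivisorMonoids.Prop34Cnst T₀ cnst)
    (hΔcnst : ∀ δ ∈ T.aug.ker,
      cnst.map (S.tf.base.map (rhoOfBiKummerData R ιX δ).hom) = 𝟙 (cnst.obj (S.tf.base.obj R.BN.base))) :
    Thm56Sub.CyclotomeCentralUnderLDeltaGal
      (ofBiKummerData h toB Q odd_l R ιX hopen σ K' constEmb constEmb_injective hdivc hdivp) P :=
  Thm56Sub.cyclotomeCentral_of_unitsCentral_gal _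
    (unitsCentralUnderLDelta_ofBiKummerData_of_cnst_galois h toB Q odd_l R ιX hopen σ K' constEmb constEmb_injective hdivc hdivp
      hσ P hgeom hP34 hΔcnst)

end Cnst

/-! ### (3) Bookkeeping: the v1 heads ARE the `toGalois` instances of the v2 heads (any `Gal`) -/

section Bookkeeping

variable {K : Type u₀} [Field K]
variable {X : SemiGraphs.TemperedArithmeticGroup.{u₀} K} {D₀ : Type u₀} [Category.{v₀} D₀]
  {V : FrdIMonoidStub.{w}} {T₀ : RealifiedDivisorMonoids (D₀ := D₀) V} {D : Type u} [Category.{v} D]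
  {VD : FrdICatStub.{u, v, w} D} {S : BiKummerSetting X T₀ D VD}
  {pullFrac : ∀ {A A' : S.C} (_ : A' ⟶ A), S.biratUnits A → S.biratUnits A'}
  {lv N : ℕ+} {T : ThetaEnvData.{max v w} N} {θ : S.biratUnits S.Aodot} {Bl : S.C}
  {Pl : S.FractionPair θ Bl} {Rl : S.NthRoot θ Pl lv pullFrac}
  (h : ModelFrobenioid.Hypotheses S.tf.divisorMonoid S.tf.ratFnFunctor)
  (toB : ∀ A : S.C, S.biratUnits A →* S.tf.biratUnitsModel A) (Q : FrobenioidTheta.ThetaSubquotientStub.{w} D)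
  (odd_l : Odd (lv : ℕ)) (R : S.NthRoot Rl.root Rl.pair N pullFrac) (ιX : T.PiX ≃ₜ* X.Pi)
  (hopen : IsOpen ((S.galoisSurj R.AN.base R.αData.isGalois).ker : Set X.Pi)) (σ : Aut R.AN.base →* Aut R.AN)
  (K' : Type w) [Field K'] (constEmb : K'ˣ →* S.tf.biratUnitsModel R.BN)
  (constEmb_injective : Function.Injective constEmb)
  (hdivc : ∀ g : Aut R.BN.base,
    ModelFrobenioid.div ((σ ((BiKummerSetting.NthRoot.baseIso S R).conjAut.symm g)).hom ≫ R.pair.num) =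
      ModelFrobenioid.div R.pair.num)
  (hdivp : ∀ y : T.PiYdd,
    ModelFrobenioid.div ((σ (S.galoisSurj R.AN.base R.αData.isGalois (ιX y.1))).hom ≫ R.pair.den) =
      ModelFrobenioid.div R.pair.den)
  {Dcnst : Type u₁} [Category.{v₁} Dcnst] {cnst : D₀ ⥤ Dcnst}

/-- abc-iut-w5-d020's v1 head `unitsCentralUnderLDelta_ofBiKummerData_of_cnst` is the instance of the v2 head at the forgotten record
`P.toGalois Gal` (abc-iut-w6-d079's `Iff.rfl` bridge `unitsCentralUnderLDeltaGal_toGalois_iff`) — bookkeeping check that the re-keying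
is a binder-type change.  [cite: MochizukiEtTh2009, Thm 5.6 proof p.329 (PDF p.103)] -/
theorem unitsCentralUnderLDelta_ofBiKummerData_of_cnst_of_toGalois (Gal : D → Prop)
    (hσ : ∀ g : Aut R.AN.base, ModelFrobenioid.baseMap (σ g).hom = g.hom)
    (P : ThetaSubquotientProj (ofBiKummerData h toB Q odd_l R ιX hopen σ K' constEmb constEmb_injective hdivc hdivp))
    (hgeom : P.pre R.BN.base ≤ T.aug.ker.map (rhoOfBiKummerData R ιX))
    (hP34 : RealifiedDivisorMonoids.Prop34Cnst T₀ cnst)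
    (hΔcnst : ∀ δ ∈ T.aug.ker,
      cnst.map (S.tf.base.map (rhoOfBiKummerData R ιX δ).hom) = 𝟙 (cnst.obj (S.tf.base.obj R.BN.base))) :
    Thm56Sub.UnitsCentralUnderLDelta
      (ofBiKummerData h toB Q odd_l R ιX hopen σ K' constEmb constEmb_injective hdivc hdivp) P :=
  (Thm56Sub.unitsCentralUnderLDeltaGal_toGalois_iff _ Gal P).mp
    (unitsCentralUnderLDelta_ofBiKummerData_of_cnst_galois h toB Q odd_l R ιX hopen σ K' constEmb constEmb_injective hdivc hdivp
      hσ (P.toGalois Gal) hgeom hP34 hΔcnst)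

end Bookkeeping

end ThetaFrobenioid

end Literature.AnabelianGeometry.EtaleTheta

end
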